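import Literature.Geometry.Lorentzian.ObstructionFreeGluing
import Literature.Geometry.Lorentzian.CoordConstraintBridge
import HarnessLib

/-!
# The shell vacuum predicate `VacOn` of the annular gluing theorem, in coordinates

(trunk G08 = T-LORENTZ; family `gr`; namespace `Literature.Geometry.Lorentzian.InitialDataSet`.)

The fact `MaoOhTao.ObstructionFreeAnnularGluing` (`ObstructionFreeGluing.lean`; Mao–Oh–Tao 2023,
Thm. 1.7) states its hypotheses `Din.VacOn 1 2`, `Dout.VacOn 32 64` and its conclusion
`D.VacOn 1 64` through the abstract constraint functions of `InitialData.lean`, while the paper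
(§2.1, (2.6)–(2.7)) and every analytic argument work with the constraint *equations for the
components* `(g_{ij}, k_{ij}) = (coordH D, coordK D)`. Using the link file
`CoordConstraintBridge.lean` (`InitialDataSet.isVacuumAt_iff_coord`: the constraint map of a datum
on `ℝ³` is the coordinate constraint map `(hamAt, momFn)` of its components), this file records

* `InitialDataSet.VacOn_iff_coord` — `D.VacOn a c ↔ ∀ y, a < |y| < c →
  hamAt (coordH D) (coordK D) y = 0 ∧ ∀ v, momFn b (coordH D) (coordK D) y v = 0` (any basis `b`);
* `InitialDataSet.VacOn.hamAt_eq_zero`, `InitialDataSet.VacOn.momFn_eq_zero` — the two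
  component equations on the shell.

So the whole coordinate deformation calculus of the `MetricCoord` files (linearised constraint
map `DΦ`, its adjoint `DΦ*`, the Green identity and the KID corollary of
`CoordConstraintAdjoint.lean`) applies verbatim to the data of the annular gluing theorem; its
flat, averaged instance is `LinearChargeConservation.lean` (Mao–Oh–Tao Lemma 2.7).

Everything is proved; no definitions, no named facts.

## References

* Y. Mao, S.-J. Oh, T. Tao, arXiv:2308.13031 (2023), §2.1, (2.6)–(2.7) (key `MaoOhTao2023`).
* R. Bartnik, J. Isenberg, *The constraint equations* (2004), §2, (2.1)–(2.2)
  (key `BartnikIsenberg2004`).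
-/

noncomputable section

open scoped Manifold

namespace Literature.Geometry.Lorentzian

namespace InitialDataSet

open _root_.Module (Basis)

/-- **The shell vacuum predicate in coordinates**: a datum `D` on `ℝ³` solves the vacuum constraints on the open shell
`{a < |y| < c}` iff the coordinate constraint map of its components vanishes there,
`hamAt (coordH D) (coordK D) y = 0 ∧ ∀ v, momFn b (coordH D) (coordK D) y v = 0` (any basis `b`;
`isVacuumAt_iff_coord`, the Levi-Civita hypothesis discharged by `PseudoRiemannianMetric.hasLeviCivita`). This is
(2.6)–(2.7) of Mao–Oh–Tao for the data of `ObstructionFreeAnnularGluing`. [cite: MaoOhTao2023, §2.1, (2.6)–(2.7)] -/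
theorem VacOn_iff_coord {ι : Type*} [Fintype ι] (b : Basis ι ℝ E3) (D : InitialDataSet (𝓡 3) E3)
    (a c : ℝ) :
    D.VacOn a c ↔ ∀ y : E3, a < ‖y‖ → ‖y‖ < c →
      MetricCoord.hamAt D.coordH D.coordK y = 0 ∧
        ∀ v : E3, MetricCoord.momFn b D.coordH D.coordK y v = 0 := by
  constructor
  · intro h y ha hc
    haveI : D.metric.HasLeviCivita := PseudoRiemannianMetric.hasLeviCivita _
    exact (D.isVacuumAt_iff_coord b y).1 (h y ha hc)
  · intro h _ y ha hc
    exact (D.isVacuumAt_iff_coord b y).2 (h y ha hc)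

/-- On the shell of `D.VacOn a c` the Hamiltonian constraint of the components holds:
`S_g − |k|²_g + (tr_g k)² = 0` in coordinates. [cite: MaoOhTao2023, §2.1, (2.6)] -/
theorem VacOn.hamAt_eq_zero {D : InitialDataSet (𝓡 3) E3} {a c : ℝ} (h : D.VacOn a c) {y : E3}
    (ha : a < ‖y‖) (hc : ‖y‖ < c) : MetricCoord.hamAt D.coordH D.coordK y = 0 :=
  (((VacOn_iff_coord (EuclideanSpace.basisFun (Fin 3) ℝ).toBasis D a c).1 h) y ha hc).1

/-- On the shell of `D.VacOn a c` the momentum constraint of the components holds in any basis: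
`(div_g k − d tr_g k)(v) = 0` in coordinates. [cite: MaoOhTao2023, §2.1, (2.7)] -/
theorem VacOn.momFn_eq_zero {ι : Type*} [Fintype ι] (b : Basis ι ℝ E3) {D : InitialDataSet (𝓡 3) E3}
    {a c : ℝ} (h : D.VacOn a c) {y : E3} (ha : a < ‖y‖) (hc : ‖y‖ < c) (v : E3) :
    MetricCoord.momFn b D.coordH D.coordK y v = 0 :=
  (((VacOn_iff_coord b D a c).1 h) y ha hc).2 v

end InitialDataSet

end Literature.Geometry.Lorentzian

end
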